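import Summits.CriticalPhenomena.PercolationContinuityZ3.Theorems.PercNearOneGluingNoHeavyLowerTailSunflowerLSMGraded

/-!
# `NoHeavyLowerTail` (crux stmt-CriticalPhenomena-4575), abstract sunflower cubic: THE LOG-SUPERMODULAR CLASS 𝓛
# (Theorem B of the memo) — leaves, disjoint conjunctions, disjunction with one new leaf — and its graded safety

Support file (seat `prim-ineq-prove-1` gen 35; `--supports stmt-CriticalPhenomena-4575`).  No `sorry`, no named facts.
Memo: run/shared/lean/prim/prim-ineq-prove-1/FINDING-LSM-prove1-g35.md §4–§5.

* `LSMFam p a A 𝒯` — `𝒯` is a family of bad subsets of the block `a` covering every bad missing set, whose family functional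
  `famIn p a 𝒯` (the hitting function) is LOG-SUPERMODULAR.  `gsafe_of_lsmFam`: then `A` is gradedly safe (`gsafe_of_lsm`).
* closure rules: `lsmFam_leaf` (`{ω | e ∈ ω}`, block `{e}`, family `{{e}}`); **`lsmFam_and`** (intersection on disjoint blocks: the
  functional factorises, `famIn_and`); **`lsmFam_orLeaf`** (`A ∪ {ω | e ∈ ω}` for a NEW coordinate `e`: the functional becomes
  `p_e + (1 − p_e)·famIn`, `famIn_orLeaf`, and `α + β·(LSM nondecreasing)` is LSM).
The formula class 𝓛 itself (`LF`, `LF.gsafe`) and the examples are in the next file `…SunflowerLSMClass`.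
-/

noncomputable section

namespace Summit.CriticalPhenomena.PercolationContinuityZ3.Theorems.SunflowerPartition

namespace SafeCalc

open MeasureTheory Finset
open Literature.Probability.LatticeModels Literature.Probability.Percolation
open TwoGenCore (wmiss)

variable {ι : Type*} [DecidableEq ι] (p : ι → unitInterval)

/-- A LOG-SUPERMODULAR FAMILY for the event `A` on the block `a`: members inside the block, all bad, covering every bad missing
set, with log-supermodular family functional. [this work] -/
def LSMFam (a : Finset ι) (A : Set (Set ι)) (𝒯 : Finset (Finset ι)) : Prop :=
  (∀ C ∈ 𝒯, C ⊆ a) ∧ (∀ C ∈ 𝒯, ((a \ C : Finset ι) : Set ι) ∉ A) ∧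
    (∀ T, T ⊆ a → ((a \ T : Finset ι) : Set ι) ∉ A → ∃ C ∈ 𝒯, C ⊆ T) ∧
    (∀ 𝒰 𝒱 : Finset (Finset ι), famIn p a 𝒯 𝒰 * famIn p a 𝒯 𝒱 ≤ famIn p a 𝒯 (𝒰 ∪ 𝒱) * famIn p a 𝒯 (𝒰 ∩ 𝒱))

/-- Graded safety from a log-supermodular family (wrapper of `gsafe_of_lsm`). [this work] -/
theorem gsafe_of_lsmFam [Fintype ι] {a : Finset ι} {A : Set (Set ι)} {𝒯 : Finset (Finset ι)}
    (hd : DeterminedBy A (↑a : Set ι)) (hu : IsUpperSet A) (h : LSMFam p a A 𝒯) : GSafe p a A :=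
  gsafe_of_lsm p a hd hu 𝒯 h.1 h.2.1 h.2.2.1 h.2.2.2

/-! ## Families with a single member (leaves) -/

/-- For a one-member family the functional only sees whether that member is allowed. [this work] -/
theorem famIn_single (a C₀ : Finset ι) (𝒰 : Finset (Finset ι)) :
    famIn p a {C₀} 𝒰 = if C₀ ∈ 𝒰 then 1 else famIn p a {C₀} ∅ := by
  split_ifs with h
  · unfold famIn
    have : (fun T : Finset ι => if ∀ C ∈ ({C₀} : Finset (Finset ι)), C ⊆ T → C ∈ 𝒰 then (1 : ℝ) else 0) = fun _ => 1 := by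
      funext T; rw [if_pos]; intro C hC _; rw [mem_singleton] at hC; rw [hC]; exact h
    rw [this, BEx_const]
  · unfold famIn
    congr 1; funext T
    have : (∀ C ∈ ({C₀} : Finset (Finset ι)), C ⊆ T → C ∈ 𝒰) ↔ (∀ C ∈ ({C₀} : Finset (Finset ι)), C ⊆ T → C ∈ (∅ : Finset (Finset ι))) := by
      simp only [mem_singleton, forall_eq, notMem_empty, imp_false]
      exact ⟨fun h1 h2 => h (h1 h2), fun h1 h2 => absurd h2 h1⟩
    simp only [this]

/-- One-member families are log-supermodular (with equality). [this work] -/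
theorem lsm_single (a C₀ : Finset ι) (𝒰 𝒱 : Finset (Finset ι)) :
    famIn p a {C₀} 𝒰 * famIn p a {C₀} 𝒱 ≤ famIn p a {C₀} (𝒰 ∪ 𝒱) * famIn p a {C₀} (𝒰 ∩ 𝒱) := by
  rw [famIn_single p a C₀ 𝒰, famIn_single p a C₀ 𝒱, famIn_single p a C₀ (𝒰 ∪ 𝒱), famIn_single p a C₀ (𝒰 ∩ 𝒱)]
  by_cases hU : C₀ ∈ 𝒰 <;> by_cases hV : C₀ ∈ 𝒱 <;>
    simp only [hU, hV, if_true, if_false, mem_union, mem_inter, or_true, or_false, and_true,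
      and_false, one_mul, mul_one, le_refl]

/-- **Leaves**: `{ω | e ∈ ω}` on the block `{e}` with the family `{{e}}`. [this work] -/
theorem lsmFam_leaf (e : ι) : LSMFam p {e} {ω | e ∈ ω} {{e}} := by
  refine ⟨fun C hC => by rw [mem_singleton] at hC; rw [hC], fun C hC => ?_, fun T hT hTA => ?_, lsm_single p {e} {e}⟩
  · rw [mem_singleton] at hC; subst hC
    simp only [sdiff_self, bot_eq_empty, coe_empty, Set.mem_setOf_eq, Set.mem_empty_iff_false, not_false_eq_true]
  · refine ⟨{e}, mem_singleton_self _, ?_⟩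
    intro x hx; rw [mem_singleton] at hx; subst hx
    by_contra hxT
    refine hTA ?_
    change x ∈ (({x} \ T : Finset ι) : Set ι)
    rw [Finset.mem_coe, Finset.mem_sdiff, Finset.mem_singleton]
    exact ⟨rfl, hxT⟩

/-! ## Conjunction on disjoint blocks -/

/-- Block points of `a ∪ b` versus block points of `a`, for an event determined by `a`. [this work] -/
theorem mem_iff_of_determinedBy {a b T : Finset ι} {A : Set (Set ι)} (hd : DeterminedBy A (↑a : Set ι)) :
    (((a ∪ b) \ T : Finset ι) : Set ι) ∈ A ↔ ((a \ (T ∩ a) : Finset ι) : Set ι) ∈ A := by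
  rw [determinedBy_iff] at hd
  refine hd _ _ ?_
  ext x
  simp only [Set.mem_inter_iff, Finset.mem_coe, Finset.mem_sdiff, Finset.mem_union, Finset.mem_inter]
  constructor
  · rintro ⟨⟨_, hxT⟩, hxa⟩; exact ⟨⟨hxa, fun h => hxT h.1⟩, hxa⟩
  · rintro ⟨⟨hxa, hxT⟩, _⟩; exact ⟨⟨Or.inl hxa, fun h => hxT ⟨h, hxa⟩⟩, hxa⟩

/-- **Product formula**: on disjoint blocks the family functional of `𝒯 ∪ 𝒮` factorises. [this work] -/
theorem famIn_and {a b : Finset ι} (hab : Disjoint a b) {𝒯 𝒮 : Finset (Finset ι)} (h𝒯 : ∀ C ∈ 𝒯, C ⊆ a)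
    (h𝒮 : ∀ C ∈ 𝒮, C ⊆ b) (𝒰 : Finset (Finset ι)) :
    famIn p (a ∪ b) (𝒯 ∪ 𝒮) 𝒰 = famIn p a 𝒯 𝒰 * famIn p b 𝒮 𝒰 := by
  unfold famIn
  rw [BEx_union p hab]
  have key : ∀ T₁ ∈ a.powerset, ∀ T₂ ∈ b.powerset,
      (if ∀ C ∈ 𝒯 ∪ 𝒮, C ⊆ T₁ ∪ T₂ → C ∈ 𝒰 then (1 : ℝ) else 0) =
        (if ∀ C ∈ 𝒯, C ⊆ T₁ → C ∈ 𝒰 then (1 : ℝ) else 0) * (if ∀ C ∈ 𝒮, C ⊆ T₂ → C ∈ 𝒰 then (1 : ℝ) else 0) := by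
    intro T₁ hT₁ T₂ hT₂
    rw [mem_powerset] at hT₁ hT₂
    have h1 : ∀ C ∈ 𝒯, (C ⊆ T₁ ∪ T₂ ↔ C ⊆ T₁) := by
      intro C hC
      refine ⟨fun h x hx => ?_, fun h => h.trans subset_union_left⟩
      rcases mem_union.1 (h hx) with h' | h'
      · exact h'
      · exact absurd (hT₂ h') (Finset.disjoint_left.1 hab (h𝒯 C hC hx))
    have h2 : ∀ C ∈ 𝒮, (C ⊆ T₁ ∪ T₂ ↔ C ⊆ T₂) := by
      intro C hC
      refine ⟨fun h x hx => ?_, fun h => h.trans subset_union_right⟩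
      rcases mem_union.1 (h hx) with h' | h'
      · exact absurd (hT₁ h') (Finset.disjoint_right.1 hab (h𝒮 C hC hx))
      · exact h'
    have hiff : (∀ C ∈ 𝒯 ∪ 𝒮, C ⊆ T₁ ∪ T₂ → C ∈ 𝒰) ↔
        (∀ C ∈ 𝒯, C ⊆ T₁ → C ∈ 𝒰) ∧ (∀ C ∈ 𝒮, C ⊆ T₂ → C ∈ 𝒰) := by
      constructor
      · intro h
        exact ⟨fun C hC hCT => h C (mem_union_left _ hC) ((h1 C hC).2 hCT),
          fun C hC hCT => h C (mem_union_right _ hC) ((h2 C hC).2 hCT)⟩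
      · rintro ⟨hA, hB⟩ C hC hCT
        rcases mem_union.1 hC with hC' | hC'
        · exact hA C hC' ((h1 C hC').1 hCT)
        · exact hB C hC' ((h2 C hC').1 hCT)
    by_cases hA : ∀ C ∈ 𝒯, C ⊆ T₁ → C ∈ 𝒰 <;> by_cases hB : ∀ C ∈ 𝒮, C ⊆ T₂ → C ∈ 𝒰
    · rw [if_pos (hiff.2 ⟨hA, hB⟩), if_pos hA, if_pos hB, mul_one]
    · rw [if_neg (fun h => hB (hiff.1 h).2), if_neg hB, mul_zero]
    · rw [if_neg (fun h => hA (hiff.1 h).1), if_neg hA, zero_mul]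
    · rw [if_neg (fun h => hA (hiff.1 h).1), if_neg hA, zero_mul]
  unfold BEx
  beta_reduce
  rw [Finset.sum_mul]
  refine sum_congr rfl fun T₁ hT₁ => ?_
  have inner : ∑ T₂ ∈ b.powerset, wmiss p b T₂ * (if ∀ C ∈ 𝒯 ∪ 𝒮, C ⊆ T₁ ∪ T₂ → C ∈ 𝒰 then (1 : ℝ) else 0) =
      (if ∀ C ∈ 𝒯, C ⊆ T₁ → C ∈ 𝒰 then (1 : ℝ) else 0) *
        ∑ T₂ ∈ b.powerset, wmiss p b T₂ * (if ∀ C ∈ 𝒮, C ⊆ T₂ → C ∈ 𝒰 then (1 : ℝ) else 0) := by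
    rw [Finset.mul_sum]
    refine sum_congr rfl fun T₂ hT₂ => ?_
    rw [key T₁ hT₁ T₂ hT₂]; ring
  rw [inner]; ring

/-- **Conjunction**: log-supermodular families on disjoint blocks combine. [this work] -/
theorem lsmFam_and {a b : Finset ι} (hab : Disjoint a b) {A B : Set (Set ι)} {𝒯 𝒮 : Finset (Finset ι)}
    (hdA : DeterminedBy A (↑a : Set ι)) (hdB : DeterminedBy B (↑b : Set ι))
    (hA : LSMFam p a A 𝒯) (hB : LSMFam p b B 𝒮) : LSMFam p (a ∪ b) (A ∩ B) (𝒯 ∪ 𝒮) := by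
  obtain ⟨hTa, hTbad, hTcov, hTlsm⟩ := hA
  obtain ⟨hSb, hSbad, hScov, hSlsm⟩ := hB
  refine ⟨fun C hC => ?_, fun C hC => ?_, fun T hT hbad => ?_, fun 𝒰 𝒱 => ?_⟩
  · rcases mem_union.1 hC with h | h
    · exact (hTa C h).trans subset_union_left
    · exact (hSb C h).trans subset_union_right
  · rcases mem_union.1 hC with h | h
    · intro hmem
      have h1 := (mem_iff_of_determinedBy (b := b) hdA).1 hmem.1
      rw [inter_eq_left.2 (hTa C h)] at h1
      exact hTbad C h h1
    · intro hmem
      have h1 := (mem_iff_of_determinedBy (b := a) hdB).1 (by rw [union_comm]; exact hmem.2)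
      rw [inter_eq_left.2 (hSb C h)] at h1
      exact hSbad C h h1
  · -- a bad point fails A or fails B
    rw [Set.mem_inter_iff, not_and_or] at hbad
    rcases hbad with hA' | hB'
    · have h1 : ((a \ (T ∩ a) : Finset ι) : Set ι) ∉ A := fun h => hA' ((mem_iff_of_determinedBy (b := b) hdA).2 h)
      obtain ⟨C, hC, hCT⟩ := hTcov (T ∩ a) inter_subset_right h1
      exact ⟨C, mem_union_left _ hC, hCT.trans inter_subset_left⟩
    · have h1 : ((b \ (T ∩ b) : Finset ι) : Set ι) ∉ B := fun h =>
        hB' (by rw [union_comm]; exact (mem_iff_of_determinedBy (b := a) hdB).2 h)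
      obtain ⟨C, hC, hCT⟩ := hScov (T ∩ b) inter_subset_right h1
      exact ⟨C, mem_union_right _ hC, hCT.trans inter_subset_left⟩
  · rw [famIn_and p hab hTa hSb, famIn_and p hab hTa hSb, famIn_and p hab hTa hSb, famIn_and p hab hTa hSb]
    have h1 := hTlsm 𝒰 𝒱
    have h2 := hSlsm 𝒰 𝒱
    have n1 := famIn_nonneg p a 𝒯 𝒰; have n2 := famIn_nonneg p a 𝒯 𝒱
    have n3 := famIn_nonneg p b 𝒮 𝒰; have n4 := famIn_nonneg p b 𝒮 𝒱
    calc famIn p a 𝒯 𝒰 * famIn p b 𝒮 𝒰 * (famIn p a 𝒯 𝒱 * famIn p b 𝒮 𝒱)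
        = (famIn p a 𝒯 𝒰 * famIn p a 𝒯 𝒱) * (famIn p b 𝒮 𝒰 * famIn p b 𝒮 𝒱) := by ring
      _ ≤ (famIn p a 𝒯 (𝒰 ∪ 𝒱) * famIn p a 𝒯 (𝒰 ∩ 𝒱)) * (famIn p b 𝒮 (𝒰 ∪ 𝒱) * famIn p b 𝒮 (𝒰 ∩ 𝒱)) :=
          mul_le_mul h1 h2 (mul_nonneg n3 n4) (mul_nonneg (famIn_nonneg p a 𝒯 _) (famIn_nonneg p a 𝒯 _))
      _ = famIn p a 𝒯 (𝒰 ∪ 𝒱) * famIn p b 𝒮 (𝒰 ∪ 𝒱) * (famIn p a 𝒯 (𝒰 ∩ 𝒱) * famIn p b 𝒮 (𝒰 ∩ 𝒱)) := by ring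

/-! ## Disjunction with one new leaf -/

/-- Block expectation over a single coordinate. [this work] -/
theorem BEx_single (e : ι) (G : Finset ι → ℝ) : BEx p {e} G = (p e : ℝ) * G ∅ + (1 - (p e : ℝ)) * G {e} := by
  unfold BEx
  have hps : ({e} : Finset ι).powerset = {∅, {e}} := by
    rw [← insert_empty_eq e, Finset.powerset_insert, Finset.powerset_empty]
    simp only [image_singleton, insert_empty_eq]
    rfl
  rw [hps, sum_pair (by simp)]
  unfold TwoGenCore.wmiss
  simp only [prod_empty, one_mul, sdiff_empty, prod_singleton, sdiff_self, bot_eq_empty, mul_one]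

/-- **One new leaf**: the family functional of `𝒯 ∨ e := {C ∪ {e}}` on the block `a ∪ {e}` is `p_e + (1 − p_e)·famIn` of the
pulled-back family. [this work] -/
theorem famIn_orLeaf {a : Finset ι} {e : ι} (he : e ∉ a) {𝒯 : Finset (Finset ι)} (h𝒯 : ∀ C ∈ 𝒯, C ⊆ a)
    (𝒰 : Finset (Finset ι)) :
    famIn p (a ∪ {e}) (𝒯.image fun C => C ∪ {e}) 𝒰 =
      (p e : ℝ) + (1 - (p e : ℝ)) * famIn p a 𝒯 (𝒯.filter fun C => C ∪ {e} ∈ 𝒰) := by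
  have hae : Disjoint a {e} := disjoint_singleton_right.2 he
  unfold famIn
  rw [BEx_union p hae]
  have key : ∀ T₁ ∈ a.powerset, BEx p {e} (fun T₂ => if ∀ C ∈ 𝒯.image (fun C => C ∪ ({e} : Finset ι)),
      C ⊆ T₁ ∪ T₂ → C ∈ 𝒰 then (1 : ℝ) else 0) = (p e : ℝ) + (1 - (p e : ℝ)) *
        (if ∀ C ∈ 𝒯, C ⊆ T₁ → C ∈ 𝒯.filter (fun C => C ∪ ({e} : Finset ι) ∈ 𝒰) then (1 : ℝ) else 0) := by
    intro T₁ hT₁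
    rw [mem_powerset] at hT₁
    rw [BEx_single]
    have heT₁ : e ∉ T₁ := fun h => he (hT₁ h)
    have h0 : (∀ C ∈ 𝒯.image (fun C => C ∪ ({e} : Finset ι)), C ⊆ T₁ ∪ ∅ → C ∈ 𝒰) := by
      intro C hC hCT
      rw [mem_image] at hC
      obtain ⟨C', _, rfl⟩ := hC
      rw [union_empty] at hCT
      exact absurd (hCT (mem_union_right _ (mem_singleton_self e))) heT₁
    have h1 : (∀ C ∈ 𝒯.image (fun C => C ∪ ({e} : Finset ι)), C ⊆ T₁ ∪ {e} → C ∈ 𝒰) ↔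
        (∀ C ∈ 𝒯, C ⊆ T₁ → C ∈ 𝒯.filter (fun C => C ∪ ({e} : Finset ι) ∈ 𝒰)) := by
      constructor
      · intro h C hC hCT
        rw [mem_filter]
        exact ⟨hC, h _ (mem_image_of_mem _ hC) (union_subset_union hCT subset_rfl)⟩
      · intro h C hC hCT
        rw [mem_image] at hC
        obtain ⟨C', hC', rfl⟩ := hC
        have hC'T : C' ⊆ T₁ := by
          intro x hx
          have hxe : x ≠ e := fun hxe => he (h𝒯 C' hC' (hxe ▸ hx))
          rcases mem_union.1 (hCT (mem_union_left _ hx)) with h' | h'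
          · exact h'
          · exact absurd (mem_singleton.1 h') hxe
        exact (mem_filter.1 (h C' hC' hC'T)).2
    rw [if_pos h0]
    simp only [h1, mul_one]
  rw [← BEx_affine p a (p e : ℝ) (1 - (p e : ℝ))
    (fun T => if ∀ C ∈ 𝒯, C ⊆ T → C ∈ 𝒯.filter (fun C => C ∪ ({e} : Finset ι) ∈ 𝒰) then (1 : ℝ) else 0)]
  unfold BEx at key ⊢
  beta_reduce
  exact sum_congr rfl fun T hT => by rw [key T hT]

/-- `α + β·f` is log-supermodular for `α, β ≥ 0` and `f` nonnegative, nondecreasing, log-supermodular. [this work] -/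
theorem lsm_affine {α β A B B' D : ℝ} (hα : 0 ≤ α) (hβ : 0 ≤ β) (hD : 0 ≤ D) (hBA : B ≤ A) (hB'A : B' ≤ A) (hDB : D ≤ B)
    (h : B * B' ≤ A * D) : (α + β * B) * (α + β * B') ≤ (α + β * A) * (α + β * D) := by
  have hsum := LSM.add_le_add_of_mul_le hD hBA hB'A hDB h
  nlinarith [mul_nonneg hα hβ, mul_nonneg hβ hβ]

/-- **Disjunction with one new leaf**: `A ∪ {ω | e ∈ ω}` on `a ∪ {e}` with the family `{C ∪ {e}}`. [this work] -/
theorem lsmFam_orLeaf {a : Finset ι} {e : ι} (he : e ∉ a) {A : Set (Set ι)} {𝒯 : Finset (Finset ι)}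
    (hA : LSMFam p a A 𝒯) :
    LSMFam p (a ∪ {e}) (A ∪ {ω | e ∈ ω}) (𝒯.image fun C => C ∪ {e}) := by
  obtain ⟨hTa, hTbad, hTcov, hTlsm⟩ := hA
  have hsd : ∀ C, C ⊆ a → (((a ∪ {e}) \ (C ∪ {e}) : Finset ι) : Set ι) = ((a \ C : Finset ι) : Set ι) := by
    intro C hC
    ext x
    simp only [Finset.mem_coe, Finset.mem_sdiff, Finset.mem_union, Finset.mem_singleton]
    constructor
    · rintro ⟨h1 | h1, h2⟩
      · exact ⟨h1, fun h => h2 (Or.inl h)⟩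
      · exact absurd (Or.inr h1) h2
    · rintro ⟨h1, h2⟩
      exact ⟨Or.inl h1, fun h => h.elim h2 fun h' => he (h' ▸ h1)⟩
  refine ⟨fun C hC => ?_, fun C hC => ?_, fun T hT hbad => ?_, fun 𝒰 𝒱 => ?_⟩
  · rw [mem_image] at hC
    obtain ⟨C', hC', rfl⟩ := hC
    exact union_subset_union (hTa C' hC') subset_rfl
  · rw [mem_image] at hC
    obtain ⟨C', hC', rfl⟩ := hC
    rw [hsd C' (hTa C' hC')]
    rintro (h | h)
    · exact hTbad C' hC' h
    · have h' : e ∈ (a \ C' : Finset ι) := by simpa only [Set.mem_setOf_eq, Finset.mem_coe] using h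
      rw [Finset.mem_sdiff] at h'
      exact he h'.1
  · -- e must be missing, and then the a-part is bad for A
    rw [Set.mem_union, not_or] at hbad
    obtain ⟨hA', he'⟩ := hbad
    have heT : e ∈ T := by
      by_contra h
      refine he' ?_
      change e ∈ (((a ∪ {e}) \ T : Finset ι) : Set ι)
      rw [Finset.mem_coe, Finset.mem_sdiff, Finset.mem_union, Finset.mem_singleton]
      exact ⟨Or.inr rfl, h⟩
    set T₁ := T ∩ a with hT₁
    have hT₁a : T₁ ⊆ a := inter_subset_right
    have hTeq : T = T₁ ∪ {e} := by
      ext x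
      simp only [hT₁, Finset.mem_union, Finset.mem_inter, Finset.mem_singleton]
      constructor
      · intro hx
        rcases mem_union.1 (hT hx) with h | h
        · exact Or.inl ⟨hx, h⟩
        · exact Or.inr (mem_singleton.1 h)
      · rintro (⟨hx, _⟩ | rfl)
        · exact hx
        · exact heT
    have h1 : ((a \ T₁ : Finset ι) : Set ι) ∉ A := by
      rw [← hsd T₁ hT₁a, ← hTeq]; exact hA'
    obtain ⟨C, hC, hCT⟩ := hTcov T₁ hT₁a h1
    refine ⟨C ∪ {e}, mem_image_of_mem _ hC, ?_⟩
    rw [hTeq]; exact union_subset_union hCT subset_rfl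
  · rw [famIn_orLeaf p he hTa, famIn_orLeaf p he hTa, famIn_orLeaf p he hTa, famIn_orLeaf p he hTa]
    have hU : (𝒯.filter fun C => C ∪ ({e} : Finset ι) ∈ 𝒰 ∪ 𝒱) =
        (𝒯.filter fun C => C ∪ ({e} : Finset ι) ∈ 𝒰) ∪ (𝒯.filter fun C => C ∪ ({e} : Finset ι) ∈ 𝒱) := by
      rw [← Finset.filter_or]; congr 1; funext C; simp only [Finset.mem_union]
    have hI : (𝒯.filter fun C => C ∪ ({e} : Finset ι) ∈ 𝒰 ∩ 𝒱) =
        (𝒯.filter fun C => C ∪ ({e} : Finset ι) ∈ 𝒰) ∩ (𝒯.filter fun C => C ∪ ({e} : Finset ι) ∈ 𝒱) := by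
      rw [← Finset.filter_and]; congr 1; funext C; simp only [Finset.mem_inter]
    rw [hU, hI]
    set 𝒰₁ := 𝒯.filter fun C => C ∪ ({e} : Finset ι) ∈ 𝒰
    set 𝒱₁ := 𝒯.filter fun C => C ∪ ({e} : Finset ι) ∈ 𝒱
    have hp0 : 0 ≤ (p e : ℝ) := (p e).2.1
    have hp1 : 0 ≤ 1 - (p e : ℝ) := sub_nonneg.2 (p e).2.2
    exact lsm_affine hp0 hp1 (famIn_nonneg p a 𝒯 _) (famIn_mono p a 𝒯 subset_union_left)
      (famIn_mono p a 𝒯 subset_union_right) (famIn_mono p a 𝒯 inter_subset_left) (hTlsm 𝒰₁ 𝒱₁)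

end SafeCalc

end Summit.CriticalPhenomena.PercolationContinuityZ3.Theorems.SunflowerPartition
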